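import Literature.AlgebraicGeometry.ShimuraVarieties.UnitaryBallH1RestrictionToSpecialCurves
import Literature.NumberTheory.Automorphic.UnitaryGroupFieldRangeTransport
import HarnessLib

/-!
# [Liu 2021, Thm. 4.15 proof, l. 2212 / fn. 9] the detecting line of III-8′ `MR92Prop6Source`, read over a SUBFIELD CODE
# of the ball datum — the apply-shape the GS-7 closer consumes (GS programme node GS-7c)

Topic `AlgebraicGeometry/ShimuraVarieties`, namespace `Literature.AlgebraicGeometry.ShimuraVarieties.UnitaryBallUniformisationDatum`.
PROOF FILE: theorems only — no definition, no named fact, no instance, no `sorry`.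

The named fact ★ III-8′ `UnitaryBallUniformisationDatum.MR92Prop6Source D` (`UnitaryBallH1RestrictionToSpecialCurves.lean`) hands,
for every non-zero `c ∈ H¹(X(ℂ); ℂ)` of a compact arithmetic ball quotient `X` presented by `D : UnitaryBallUniformisationDatum 2 X`,
a totally positive definite LINE `W ⊆ (D.E)³` over THE DATUM'S CM subfield `D.E ⊆ ℂ`, detecting `c` on every compatible
uniformised special curve `(Y, D₁, φ, M)` (`IsCompatibleSpecialSource`, four clauses `gram`/`orthogonal`/`group`/`unif_comp`).
A consumer holding its hermitian space over an abstract CM field `L` with an embedding `τ : L →+* ℂ` (the cell's face: `F`,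
`ι₁`, `Hm V`) reads the datum through a SUBFIELD CODE: `e : L ≃+* D.E` over `τ` (`((e x) : ℂ) = τ x`) with `D.H = Hm^e` and
`D.Γ = GL(e)(Γ′)` — exactly what ★ GS-7a `HComp.RecordSystem.exists_pieces_fieldRange` (`(B q).E = ι₁(F)`) and its read-outs
`ballDatum_exists_ringEquiv_coe_eq_of_E_eq` / `ballDatum_H_eq_map_ringEquiv_of_Hℂ_eq` / `ballDatum_Γ_eq_map_ringEquiv_of_map_eq`
(`Summits/…/HComp/PiecesOfRecordFieldRange.lean`) supply for the pieces of Deligne's canonical model; they enter here AS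
HYPOTHESES (a Literature file does not import Summits).  This file proves:

* `Hℂ_eq_map_of_H_eq_map_ringEquiv` — `D.Hℂ = Hm^τ`;
* **`isCompatibleSpecialSource_of_subfieldCode`** — the four clauses READ ON `L`/`τ`-DATA for an `L`-line `W₀` coding `W`
  (`v ∈ W₀ ↔ e ∘ v ∈ W`, ★ GS-7b `CodeField`): `Mᴴ·Hm^τ·M = D₁.Hℂ`, `⟪τ∘v, M u⟫_{Hm^τ} = 0` for `v ∈ W₀`, every `γ₁ ∈ Γ₁` is the
  restriction along `M` of `τ(γ)` for some `γ ∈ Γ′`, and `φ(ℂ) ∘ unif₁ = unif ∘ M` on the cone — IMPLY `D.IsCompatibleSpecialSource W D₁ φ M`;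
* **`MR92Prop6Source.exists_line_detecting_of_subfieldCode`** — from `D.MR92Prop6Source`: every `c ≠ 0` admits a totally positive
  definite `L`-LINE `W₀ ⊆ L³` for `(Hm, (IsCMField.complexConj L).toRingEquiv.toRingHom)` (= `cmConjRingHom L` by `rfl`,
  `isTotallyPositive_cmConjRingHom_iff`) of `finrank 1` such that every `(Y, D₁, φ, M)` satisfying the four
  `L`-clauses has `φ(ℂ)^* c ≠ 0` (III-8′ + ★ GS-7b `CodeField.exists_line_of_isTotallyPositive_map_ringEquiv_subfield` + the above);
  `…_of_forall` — the same under the DATUM-UNIVERSAL binder `∀ {X} (D : UnitaryBallUniformisationDatum 2 X), D.MR92Prop6Source`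
  (the shape of the head binder of the `stub_S34` closer, A-plan2 (s1)).

The `L`-line `W₀` is the input of the generic frame engine ★
`exists_frame_formCongr_eq_finSum_of_isTotallyPositive_of_isHermitian` (`UnitaryAnisotropicLineFrame.lean`), run over `L` by the closer.
Cell `hodgecm-mathlib` (D-0151), crux `HLiu418` (24832), A-plan2's memo `GS-PROGRAMME.md` A.11 / A.13 ADDENDUM 3 (GS-7c after the GS-7a
re-scope: no re-datum, the datum is used AS HANDED).  HC_CM is NOT proved here; this file discharges no printed-citation binder by itself —
it only re-reads the named fact III-8′ (itself unproved, [MurtyRamakrishnan1992] not held) in the consumer's currency.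

## References
* [Liu2021] Y. Liu, arXiv:2102.11518 = Camb. J. Math. 9 (2021), proof of Thm. 4.15, l. 2207 and l. 2212 with footnote 9.
* [MurtyRamakrishnan1992] V. K. Murty, D. Ramakrishnan, *The Albanese of unitary Shimura varieties* (CRM 1992), Prop. 6 / Lemma B
  (locator from [Liu2021], unverified; not held).
* [BergeronMillsonMoeglin2016Balls] N. Bergeron, J. Millson, C. Moeglin, Acta Math. 216 (2016), Introduction §1.7, Part 2 §§1.1–1.2, 3.1.
-/

set_option autoImplicit false

noncomputable section

open CategoryTheory AlgebraicGeometry NumberField Matrix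

namespace Literature.AlgebraicGeometry.ShimuraVarieties

open Literature.AlgebraicGeometry.Motives (SchemeOver ComplexPoints)
open Literature.AlgebraicGeometry.HodgeTheory
open Literature.AlgebraicTopology.SingularHomology
open Literature.NumberTheory.Automorphic (cmConjRingHom)
open Literature.NumberTheory.Automorphic.CodeField

namespace UnitaryBallUniformisationDatum

variable {L : Type} [Field L] [NumberField L] [IsCMField L] (τ : L →+* ℂ)
  {X : SchemeOver ℂ} (D : UnitaryBallUniformisationDatum 2 X)
  (e : L ≃+* ↥D.E) (he : ∀ x : L, ((e x : ↥D.E) : ℂ) = τ x)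
  {Hm : Matrix (Fin 3) (Fin 3) L} (hH : D.H = Hm.map e.toRingHom)
  {Γ' : Subgroup (GL (Fin 3) L)} (hΓ : D.Γ = Γ'.map (Matrix.GeneralLinearGroup.map e.toRingHom))

/-! ## §1 Read-outs of the subfield code -/

omit [NumberField L] [IsCMField L] in
include he hH in
/-- **The complex Gram matrix of a subfield-coded datum is `Hm^τ`**: `D.H^{τ₁} = (Hm^e)^{subtype} = Hm^τ`.
[cite: BergeronMillsonMoeglin2016Balls, Part 2 §1.1] -/
theorem map_subtype_eq_map_of_H_eq_map_ringEquiv : D.H.map D.E.subtype = Hm.map τ := by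
  rw [hH, RingEquiv.toRingHom_eq_coe, RingHom.coe_coe]
  exact map_ringEquiv_map_subtype τ e he Hm

omit [NumberField L] [IsCMField L] in
include he hH in
/-- `D.Hℂ = Hm^τ` (the `Hℂ` spelling). [cite: BergeronMillsonMoeglin2016Balls, Part 2 §1.1] -/
theorem Hℂ_eq_map_of_H_eq_map_ringEquiv : D.Hℂ = Hm.map τ :=
  map_subtype_eq_map_of_H_eq_map_ringEquiv τ D e he hH

omit [NumberField L] [IsCMField L] in
include he in
/-- **The complex matrix of a transported group element is `τ(γ)`**: `(GL(e) γ)^{subtype} = γ^τ` entrywise.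
[cite: BergeronMillsonMoeglin2016Balls, Part 2 §1.2] -/
theorem coe_glMap_ringEquiv_map_subtype (γ : GL (Fin 3) L) :
    ((Matrix.GeneralLinearGroup.map e.toRingHom γ : GL (Fin 3) ↥D.E) : Matrix (Fin 3) (Fin 3) ↥D.E).map D.E.subtype =
      (γ : Matrix (Fin 3) (Fin 3) L).map τ := by
  rw [coe_glMap_ringEquiv]
  exact map_ringEquiv_map_subtype τ e he _

/-! ## §2 The four compatibility clauses read on `L`-data -/

omit [NumberField L] [IsCMField L] in
include he hH hΓ in
/-- **A compatible special source from the four clauses read over the subfield code.**  Let `W₀ ⊆ L³` code the `D.E`-line `W`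
along `e` (`v ∈ W₀ ↔ e ∘ v ∈ W`).  If a uniformised curve `(Y, D₁)` with `φ : Y ⟶ X` and `M ∈ M_{3×2}(ℂ)` satisfies (`gram`)
`Mᴴ·Hm^τ·M = D₁.Hℂ`, (`orthogonal`) `⟪τ∘v, M u⟫ = 0` for all `v ∈ W₀`, (`group`) every `γ₁ ∈ Γ₁` is `M`-intertwined with `τ(γ)`
for some `γ ∈ Γ′`, and (`unif_comp`) `φ(ℂ)(unif₁ v) = unif(M v)` on the cone, then `(Y, D₁, φ, M)` IS a compatible uniformised special
curve over `(D, W)` in the sense of ★ `IsCompatibleSpecialSource` — the datum's own subfield `D.E` never has to be named by the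
consumer. [cite: Liu2021, proof of Thm. 4.15, l. 2207 and l. 2212] [cite: BergeronMillsonMoeglin2016Balls, Part 2 §§3.1–3.3] -/
theorem isCompatibleSpecialSource_of_subfieldCode
    {W : Submodule ↥D.E (Fin 3 → ↥D.E)} {W₀ : Submodule L (Fin 3 → L)} (hW : ∀ v : Fin 3 → L, v ∈ W₀ ↔ (⇑e ∘ v) ∈ W)
    {Y : SchemeOver ℂ} (D₁ : UnitaryBallUniformisationDatum 1 Y) (φ : Y ⟶ X) (M : Matrix (Fin 3) (Fin 2) ℂ)
    (hgram : M.conjTranspose * Hm.map τ * M = D₁.Hℂ)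
    (horth : ∀ v ∈ W₀, ∀ u : Fin 2 → ℂ, hermForm (starRingEnd ℂ) (Hm.map τ) (⇑τ ∘ v) (M.mulVec u) = 0)
    (hgroup : ∀ γ₁ ∈ D₁.Γ, ∃ γ ∈ Γ',
      (γ : Matrix (Fin 3) (Fin 3) L).map τ * M = M * ((γ₁ : Matrix (Fin 2) (Fin 2) ↥D₁.E)).map D₁.E.subtype)
    (hunif : ∀ v ∈ negCone D₁.Hℂ, Motives.AlgPoints.map φ (D₁.unif v) = D.unif (M.mulVec v)) :
    D.IsCompatibleSpecialSource W D₁ φ M where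
  gram := by
    rw [map_subtype_eq_map_of_H_eq_map_ringEquiv τ D e he hH]
    exact hgram
  orthogonal w hw u := by
    have hv₀ : (⇑e.symm ∘ w) ∈ W₀ := (mem_iff_symm_comp_mem hW w).1 hw
    have hcoe : (fun i => ((w i : ↥D.E) : ℂ)) = ⇑τ ∘ (⇑e.symm ∘ w) := by
      rw [← coe_comp_ringEquiv_comp τ e he (⇑e.symm ∘ w)]
      funext i
      simp only [Function.comp_apply, RingEquiv.apply_symm_apply]
    rw [map_subtype_eq_map_of_H_eq_map_ringEquiv τ D e he hH, hcoe]
    exact horth _ hv₀ u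
  group γ₁ hγ₁ := by
    obtain ⟨γ, hγ, hγM⟩ := hgroup γ₁ hγ₁
    refine ⟨Matrix.GeneralLinearGroup.map e.toRingHom γ, ?_, ?_⟩
    · rw [hΓ]
      exact Subgroup.mem_map_of_mem _ hγ
    · rw [coe_glMap_ringEquiv_map_subtype τ D e he γ]
      exact hγM
  unif_comp := hunif

/-! ## §3 The apply-shape of III-8′ over a subfield code -/

omit [NumberField L] [IsCMField L] in
/-- Spelling bridge (by `rfl`): the tree's `cmConjRingHom L` (`AdelicUnitaryGroup.lean`, the currency of ★ `HComp.RecordSystem.exists_pieces`)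
IS `(IsCMField.complexConj L).toRingEquiv.toRingHom` (the currency of ★ GS-7b `CodeField`), so total positivity reads the same in both.
[cite: BergeronMillsonMoeglin2016Balls, Introduction §1.7] -/
theorem isTotallyPositive_cmConjRingHom_iff {L' : Type} [Field L'] [NumberField L'] [IsCMField L'] {m : Type*} [Fintype m]
    (Hm' : Matrix m m L') (W₀ : Submodule L' (m → L')) :
    IsTotallyPositive (cmConjRingHom L') Hm' W₀ ↔ IsTotallyPositive (IsCMField.complexConj L').toRingEquiv.toRingHom Hm' W₀ :=
  Iff.rfl

namespace MR92Prop6Source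

include he hH hΓ in
/-- **III-8′ over a subfield code.**  If `D.MR92Prop6Source` ([Liu2021, proof of Thm. 4.15, l. 2212 with fn. 9], named fact ★), then every
non-zero `c ∈ H¹(X(ℂ); ℂ)` has a totally positive definite `L`-LINE `W₀ ⊆ L³` for `Hm` and the complex conjugation of `L`, of `finrank 1`,
such that EVERY uniformised special curve `(Y, D₁, φ, M)` compatible with `(Hm, τ, Γ′, W₀)` in the four `L`-clauses of
`isCompatibleSpecialSource_of_subfieldCode` detects `c`: `φ(ℂ)^* c ≠ 0`.  (The `D.E`-line `W` of the fact is pulled back along `e` by ★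
`CodeField.exists_line_of_isTotallyPositive_map_ringEquiv_subfield`.)  `W₀` is the input of the frame engine ★
`exists_frame_formCongr_eq_finSum_of_isTotallyPositive_of_isHermitian` over `L`. [cite: Liu2021, proof of Thm. 4.15, l. 2212 and footnote 9; l. 2207]
[cite: MurtyRamakrishnan1992, Prop. 6 (locator unverified)] [cite: BergeronMillsonMoeglin2016Balls, Introduction §1.7 and Part 2 §3.1] -/
theorem exists_line_detecting_of_subfieldCode (h : D.MR92Prop6Source) (c : complexBetti X 1) (hc : c ≠ 0) :
    ∃ W₀ : Submodule L (Fin 3 → L), IsTotallyPositive (IsCMField.complexConj L).toRingEquiv.toRingHom Hm W₀ ∧ Module.finrank L W₀ = 1 ∧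
      ∀ (Y : SchemeOver ℂ) (D₁ : UnitaryBallUniformisationDatum 1 Y) (φ : Y ⟶ X) (M : Matrix (Fin 3) (Fin 2) ℂ),
        M.conjTranspose * Hm.map τ * M = D₁.Hℂ →
        (∀ v ∈ W₀, ∀ u : Fin 2 → ℂ, hermForm (starRingEnd ℂ) (Hm.map τ) (⇑τ ∘ v) (M.mulVec u) = 0) →
        (∀ γ₁ ∈ D₁.Γ, ∃ γ ∈ Γ',
          (γ : Matrix (Fin 3) (Fin 3) L).map τ * M = M * ((γ₁ : Matrix (Fin 2) (Fin 2) ↥D₁.E)).map D₁.E.subtype) →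
        (∀ v ∈ negCone D₁.Hℂ, Motives.AlgPoints.map φ (D₁.unif v) = D.unif (M.mulVec v)) →
          singularCohomology.map ℂ ℂ (Motives.AlgPoints.mapContinuous (L := ℂ) φ) 1 c ≠ 0 := by
  obtain ⟨W, hWpos, hW1, hall⟩ := h c hc
  have hWpos' : IsTotallyPositive (conjRingHom D.E) (Hm.map e) W := by
    have hH' : D.H = Hm.map e := by rw [hH, RingEquiv.toRingHom_eq_coe, RingHom.coe_coe]
    rw [← hH']
    exact hWpos
  obtain ⟨W₀, hW₀, hpos₀, h1₀⟩ := exists_line_of_isTotallyPositive_map_ringEquiv_subfield τ e he Hm W hWpos' hW1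
  refine ⟨W₀, hpos₀, h1₀, fun Y D₁ φ M hgram horth hgroup hunif => ?_⟩
  exact hall Y D₁ φ M
    (isCompatibleSpecialSource_of_subfieldCode τ D e he hH hΓ hW₀ D₁ φ M hgram horth hgroup hunif)

include he hH hΓ in
/-- **The same under the DATUM-UNIVERSAL binder** `∀ {X} (D : UnitaryBallUniformisationDatum 2 X), D.MR92Prop6Source` — the quantifier
prefix of the ★ definition itself, the shape in which the `stub_S34` closer carries III-8′ to the head (A-plan2 (s1)): the opaque subfield of a
record's piece is then immaterial, the fact being applied to the piece AS HANDED. [cite: Liu2021, proof of Thm. 4.15, l. 2212 and footnote 9]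
[cite: MurtyRamakrishnan1992, Prop. 6 (locator unverified)] -/
theorem exists_line_detecting_of_forall
    (hMR : ∀ {X' : SchemeOver ℂ} (D' : UnitaryBallUniformisationDatum 2 X'), D'.MR92Prop6Source)
    (c : complexBetti X 1) (hc : c ≠ 0) :
    ∃ W₀ : Submodule L (Fin 3 → L), IsTotallyPositive (IsCMField.complexConj L).toRingEquiv.toRingHom Hm W₀ ∧ Module.finrank L W₀ = 1 ∧
      ∀ (Y : SchemeOver ℂ) (D₁ : UnitaryBallUniformisationDatum 1 Y) (φ : Y ⟶ X) (M : Matrix (Fin 3) (Fin 2) ℂ),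
        M.conjTranspose * Hm.map τ * M = D₁.Hℂ →
        (∀ v ∈ W₀, ∀ u : Fin 2 → ℂ, hermForm (starRingEnd ℂ) (Hm.map τ) (⇑τ ∘ v) (M.mulVec u) = 0) →
        (∀ γ₁ ∈ D₁.Γ, ∃ γ ∈ Γ',
          (γ : Matrix (Fin 3) (Fin 3) L).map τ * M = M * ((γ₁ : Matrix (Fin 2) (Fin 2) ↥D₁.E)).map D₁.E.subtype) →
        (∀ v ∈ negCone D₁.Hℂ, Motives.AlgPoints.map φ (D₁.unif v) = D.unif (M.mulVec v)) →
          singularCohomology.map ℂ ℂ (Motives.AlgPoints.mapContinuous (L := ℂ) φ) 1 c ≠ 0 :=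
  exists_line_detecting_of_subfieldCode τ D e he hH hΓ (hMR D) c hc

end MR92Prop6Source

end UnitaryBallUniformisationDatum

end Literature.AlgebraicGeometry.ShimuraVarieties

end
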